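import Summits.HubbardSuperconductivity.HubbardSuperconductivity.Theorems.NodalWardXYDefs
import Summits.HubbardSuperconductivity.HubbardSuperconductivity.Theorems.NodalWardXYPerturbedXYOrderEntire

/-!
# `PerturbedXYOrder` (stmt-HubbardSuperconductivity-10739) — line `schwarz-inheritance`, stub `stub_twistReflection`

**Spin-flip symmetry of the twisted two-current tilt.**  For every kernel `K`, every coupling `J` and
every site-dependent rotation `g` of the torus `(ℤ/Lℤ)³`,

  `∫_cube W_K(θ + g) w_J(θ) dθ = ∫_cube W_K(θ − g) w_J(θ) dθ`.

Proof: the reflection `R θ = (x ↦ 2π − θ x)` maps the cube `[0, 2π]^Λ` onto itself and preserves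
Lebesgue measure on `ℝ^Λ` (it is the product of the one-dimensional maps `t ↦ 2π − t`, packaged as
`MeasurableEquiv.arrowCongr' (Equiv.refl Λ) (MeasurableEquiv.subLeft (2π))`, measure preserving by
`volume_preserving_arrowCongr'` and `Measure.measurePreserving_sub_left`); every bond difference flips
sign exactly, `∇_b (R θ) = −∇_b θ`, so the ferromagnetic weight is invariant (`cos` is even) and each
current satisfies `j_b (R θ − g) = −j_b (θ + g)`, whence `W_K (R θ − g) = W_K (θ + g)` because `W_K` is
bilinear in the currents.  The change of variables `θ ↦ R θ` (`MeasurePreserving.setIntegral_preimage_emb`)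
then turns `∫_cube W_K(θ − g) w_J(θ)` into `∫_cube W_K(θ + g) w_J(θ)`.
-/

noncomputable section

namespace Summit.HubbardSuperconductivity.HubbardSuperconductivity.Theorems.PerturbedXYOrder

open MeasureTheory Literature.Probability.LatticeModels
open Summit.HubbardSuperconductivity.HubbardSuperconductivity.Theses.NodalWardXY

variable {L : ℕ}

/-- Under the reflection `θ ↦ 2π − θ` every twisted current flips sign:
`j_b ((2π − θ) − g) = −j_b (θ + g)`. -/
theorem trf_cur_flip (b : Bond L) (θ g : TorusSite 3 L → ℝ) :
    cur b ((fun x => 2 * Real.pi - θ x) - g) = -cur b (θ + g) := by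
  unfold cur
  simp only [Pi.sub_apply, Pi.add_apply]
  rw [← Real.sin_neg]
  congr 1
  ring

/-- The two-current perturbation is bilinear in the currents, so the two sign flips cancel:
`W_K ((2π − θ) − g) = W_K (θ + g)`. -/
theorem trf_Wk_flip [NeZero L] (K : Bond L → Bond L → ℂ) (θ g : TorusSite 3 L → ℝ) :
    Wk K ((fun x => 2 * Real.pi - θ x) - g) = Wk K (θ + g) := by
  unfold Wk
  refine Finset.sum_congr rfl fun b _ => Finset.sum_congr rfl fun b' _ => ?_
  rw [trf_cur_flip, trf_cur_flip]
  push_cast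
  ring

/-- The ferromagnetic weight is invariant under the reflection `θ ↦ 2π − θ` (`cos` is even and the
constants cancel in every bond difference). -/
theorem trf_wJ_flip [NeZero L] (J : ℝ) (θ : TorusSite 3 L → ℝ) :
    wJ J (fun x => 2 * Real.pi - θ x) = wJ J θ := by
  unfold wJ
  congr 3
  refine Finset.sum_congr rfl fun b _ => ?_
  rw [← Real.cos_neg]
  congr 1
  ring

/-- Change of variables `θ ↦ 2π − θ` in integrals over the cube `[0, 2π]^Λ`: the coordinatewise
reflection preserves Lebesgue measure and the cube. -/
theorem trf_setIntegral_comp_flip [NeZero L] (f : (TorusSite 3 L → ℝ) → ℂ) :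
    ∫ θ in cube L, f (fun x => 2 * Real.pi - θ x) = ∫ θ in cube L, f θ := by
  set e : (TorusSite 3 L → ℝ) ≃ᵐ (TorusSite 3 L → ℝ) :=
    MeasurableEquiv.arrowCongr' (Equiv.refl (TorusSite 3 L)) (MeasurableEquiv.subLeft (2 * Real.pi))
  have hpres : MeasurePreserving e (volume : Measure (TorusSite 3 L → ℝ)) volume :=
    volume_preserving_arrowCongr' (Equiv.refl (TorusSite 3 L)) (MeasurableEquiv.subLeft (2 * Real.pi))
      (Measure.measurePreserving_sub_left volume (2 * Real.pi))
  have hΦ : ∀ θ : TorusSite 3 L → ℝ, e θ = fun x => 2 * Real.pi - θ x := fun θ => rfl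
  have hcube : e ⁻¹' cube L = cube L := by
    ext θ
    simp only [Set.mem_preimage, hΦ, cube, Set.mem_univ_pi, Set.mem_Icc]
    refine ⟨fun h x => ?_, fun h x => ?_⟩
    · have hx := h x
      constructor <;> linarith [hx.1, hx.2]
    · have hx := h x
      constructor <;> linarith [hx.1, hx.2]
  have key := hpres.setIntegral_preimage_emb e.measurableEmbedding f (cube L)
  rw [hcube] at key
  simpa only [hΦ] using key

/-- **Spin-flip symmetry of the twisted tilt.**  For a site-dependent rotation `g`,
`∫_cube W_K(θ + g) w_J(θ) dθ = ∫_cube W_K(θ − g) w_J(θ) dθ`: change variables by the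
measure-preserving reflection `θ ↦ 2π − θ` of the cube, under which every bond difference flips
sign, `w_J` is invariant and `W_K(· − g)` becomes `W_K(· + g)` (two sign flips of the currents cancel
in the bilinear `W_K`). -/
theorem stub_twistReflection : ∀ (L : ℕ) [NeZero L] (J : ℝ) (K : Bond L → Bond L → ℂ) (g : TorusSite 3 L → ℝ),
    (∫ θ in cube L, Wk K (θ + g) * wJ J θ) = ∫ θ in cube L, Wk K (θ - g) * wJ J θ := by
  intro L _ J K g
  rw [← trf_setIntegral_comp_flip (fun θ => Wk K (θ - g) * wJ J θ)]
  congr 1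
  funext θ
  rw [trf_Wk_flip K θ g, trf_wJ_flip J θ]

end Summit.HubbardSuperconductivity.HubbardSuperconductivity.Theorems.PerturbedXYOrder

end
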